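import Summits.QuantumFields.YangMills.Theorems.FemtoCutoffLadderLargeFieldInsensitivityCompression
import Summits.QuantumFields.YangMills.Theorems.FemtoTransferGapLevelsPos
import Mathlib.Analysis.Complex.ExponentialBounds
import HarnessLib

/-!
# `LargeFieldInsensitivity` ⟸ large-field RARITY of the first two transfer eigenfunctions
# (crux stmt-QuantumFields-25696 of route `FemtoCutoffLadder` rev 12, LINE 2 of seat ym-idea-1 g4; rung R2b1 = RECORD-label femto gap;
# seat ym-line-sfw-p1 g10, `--supports stmt-QuantumFields-25696`)

The crux asks, for every `κ ∈ (0,1)`, `σ > 0`, deep in the femto window, for `0 < t_κ` and the two one-sided comparisons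
`λ₁^L t_κ^L ≤ e^{CΛ²/L^σ} s_κ^L λ₀^L`, `s_κ^L λ₀^L ≤ e^{CΛ²/L^σ} λ₁^L t_κ^L` between the femto excited ratio `λ₁/λ₀` and its SF_κ-COMPRESSED
version `s_κ/t_κ` (physical test functions vanishing at every configuration with a plaquette `2 − Re tr U_p > β^{κ−1}`).  This module proves
it FROM ONE EXPLICIT HYPOTHESIS, «eigen large-field rarity at relative precision (λ₁/λ₀)·Λ²/L^{1+σ}»:

  (R) `∃ C lam0 L0, ∀` window lattices `(L ≥ L0, β)` at level `≤ lam0`, `∀` physical `Ω`, `‖Ω‖² = 1`, `K_βΩ = λ₀Ω` or `K_βΩ = λ₁Ω`: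
      `λ₀ · (L^{1+σ} · ‖1_{bad}Ω‖²) ≤ C · Λ² · λ₁`,

for an ARBITRARY family of measurable gauge- and twist-invariant «bad» events (`compressedComparison_of_eigenRarity`, §3) and for the SF_κ
plaquette event of the crux (`largeFieldInsensitivity_text_of_eigenRarity`, §4: the crux text VERBATIM behind (R); the route module's
olean was being rebuilt at rev 12 when this was written — the by-name corollary is one `exact`).  Mechanism: the variational bookkeeping of
`…LargeFieldInsensitivityCompression.lean` — `t ≤ λ₀`, `s ≤ λ₁` (free), `t ≥ λ₀(1 − 2ε)` (cut ground state), `s ≥ λ₁ − 4ελ₀` (cut top pair) with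
`ε = CΛ²λ₁/(λ₀L^{1+σ})` — and the real-number endgames of §2 (`(1−2ε)^{−1} ≤ e^{4ε}` for `ε ≤ 1/4`; `e^{x} − 1 ≥ x`).  §1: the SF_κ cut-offs are
physical (the plaquette event is measurable, gauge invariant — conjugated holonomy, class function — and twist invariant).

D-0014 READING for the planner (no item text changed): modulo (R) the crux holds; (R) is Bałaban's large-field suppression asked of transfer
EIGENFUNCTIONS at the mild polynomial rate `(λ₁/λ₀)Λ²/L^{1+σ}` (truth: `exp(−cβ^κ)`); the factor `λ₁/λ₀ = e^{−z/L}` serves clause 1 only and is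
harmless once any `O(1)` upper bound on the femto variable `z` is known.

HONEST FRAMING: a CONDITIONAL reduction on a fixed lattice; (R) is NOT proved here; R2b1 is a RECORD rung — nothing here concerns infinite
volume, the continuum, or the Clay Yang–Mills mass gap.  No definitions, no named facts, no `sorry`.
References: Reed–Simon IV, Thm. XIII.1–2 [cite: ReedSimonIV1978, Thm. XIII.1]; T. Bałaban, CMP 122 (1989) 175 / 355 [cite: Balaban1989LargeFieldI].
-/

set_option autoImplicit false

noncomputable section

open MeasureTheory Filter Topology Real
open Literature.MathematicalPhysics.QuantumFieldTheory
open Literature.MathematicalPhysics.QuantumLattice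

namespace Summit.QuantumFields.YangMills.Theorems.FemtoTransferGap

namespace SFCompression

open OffTube

variable {L : ℕ} [NeZero L]

/-! ## §1 The small-field cut-offs are physical -/

omit [NeZero L] in
/-- Cut-offs by a measurable, gauge- and twist-invariant «bad» event `B`: `1_{¬B} f` and `1_{¬B}ᶜ f` are physical for physical `f`. [folklore] -/
theorem cutoffs_isPhys_of_invariant {B : GaugeConfig 3 L SU2 → Prop} (hBm : MeasurableSet {U | B U})
    (hBg : ∀ (g : Site 3 L → SU2) (U : GaugeConfig 3 L SU2), B (gaugeTransform g U) ↔ B U)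
    (hBz : ∀ (k : Fin 3), ∀ z ∈ Subgroup.center SU2, ∀ U : GaugeConfig 3 L SU2, B (twist k z U) ↔ B U)
    {f : GaugeConfig 3 L SU2 → ℝ} (hf : IsPhys f) :
    IsPhys ({U | ¬ B U}.indicator f) ∧ IsPhys ({U | ¬ B U}ᶜ.indicator f) := by
  have hT : MeasurableSet {U : GaugeConfig 3 L SU2 | ¬ B U} := hBm.compl
  have hTg : ∀ (g : Site 3 L → SU2) (U : GaugeConfig 3 L SU2), gaugeTransform g U ∈ {U | ¬ B U} ↔ U ∈ {U | ¬ B U} :=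
    fun g U => by simp only [Set.mem_setOf_eq, hBg g U]
  have hTz : ∀ (k : Fin 3), ∀ z ∈ Subgroup.center SU2, ∀ U : GaugeConfig 3 L SU2,
      twist k z U ∈ {U | ¬ B U} ↔ U ∈ {U | ¬ B U} := fun k z hz U => by simp only [Set.mem_setOf_eq, hBz k z hz U]
  exact ⟨isPhys_indicator hT hTg hTz hf, isPhys_indicator_compl hT hTg hTz hf⟩

omit [NeZero L] in
/-- The complement of the good set is the bad set. [folklore] -/
theorem compl_setOf_not (B : GaugeConfig 3 L SU2 → Prop) : ({U : GaugeConfig 3 L SU2 | ¬ B U})ᶜ = {U | B U} := by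
  ext U; simp

omit [NeZero L] in
/-- A good cut-off vanishes on the bad event. [folklore] -/
theorem indicator_good_vanishes (B : GaugeConfig 3 L SU2 → Prop) (f : GaugeConfig 3 L SU2 → ℝ) :
    ∀ U, B U → {U : GaugeConfig 3 L SU2 | ¬ B U}.indicator f U = 0 := fun U hU =>
  Set.indicator_of_notMem (by rw [Set.mem_setOf_eq, not_not]; exact hU) f

omit [NeZero L] in
/-- The trace of the fundamental `SU(2)` representation is a class function. [folklore] -/
theorem trace_su2Rep_conj (g h : SU2) : (su2Rep (g * h * g⁻¹)).trace = (su2Rep h).trace := by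
  rw [map_mul, map_mul, Matrix.trace_mul_cycle, ← map_mul, inv_mul_cancel, map_one, one_mul]

omit [NeZero L] in
/-- The deviation `2 − Re tr U_p` of a plaquette is continuous in the configuration. [folklore] -/
theorem continuous_plaquetteDeviation (p : Plaquette 3 L) :
    Continuous fun U : GaugeConfig 3 L SU2 => 2 - (su2Rep (plaquetteHolonomy U p.1 p.2.1.1 p.2.1.2)).trace.re :=
  continuous_const.sub (Complex.continuous_re.comp
    ((continuous_su2Rep.comp (PhysL2.continuous_plaquetteHolonomy p.1 p.2.1.1 p.2.1.2)).matrix_trace))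

/-- **The SF cut-offs are physical**: for the plaquette large-field event `∃ p, c < 2 − Re tr U_p` (any threshold `c`), the cut-offs of a
physical zero-flux test function are physical (measurable: finitely many continuous plaquette functions; gauge invariant: the holonomy is
conjugated and the trace is a class function; twist invariant: central twists do not move plaquette holonomies). [cite: tHooft1979] -/
theorem sf_cutoffs_isPhys (c : ℝ) {f : GaugeConfig 3 L SU2 → ℝ} (hf : IsPhys f) :
    IsPhys ({U : GaugeConfig 3 L SU2 | ¬ ∃ p : Plaquette 3 L,
        c < 2 - (su2Rep (plaquetteHolonomy U p.1 p.2.1.1 p.2.1.2)).trace.re}.indicator f) ∧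
      IsPhys ({U : GaugeConfig 3 L SU2 | ¬ ∃ p : Plaquette 3 L,
        c < 2 - (su2Rep (plaquetteHolonomy U p.1 p.2.1.1 p.2.1.2)).trace.re}ᶜ.indicator f) := by
  refine cutoffs_isPhys_of_invariant ?_ ?_ ?_ hf
  · have h : {U : GaugeConfig 3 L SU2 | ∃ p : Plaquette 3 L, c < 2 - (su2Rep (plaquetteHolonomy U p.1 p.2.1.1 p.2.1.2)).trace.re}
        = ⋃ p : Plaquette 3 L, {U | c < 2 - (su2Rep (plaquetteHolonomy U p.1 p.2.1.1 p.2.1.2)).trace.re} := by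
      ext U; simp only [Set.mem_setOf_eq, Set.mem_iUnion]
    rw [h]
    exact MeasurableSet.iUnion fun p => measurableSet_lt measurable_const (continuous_plaquetteDeviation p).measurable
  · intro g U
    refine exists_congr fun p => ?_
    rw [Literature.MathematicalPhysics.QuantumLattice.plaquetteHolonomy_gaugeTransform, trace_su2Rep_conj]
  · intro k z hz U
    refine exists_congr fun p => ?_
    rw [plaquetteHolonomy_twist_of_mem_center k hz U p.1 (ne_of_lt p.2.2)]

/-! ## §2 Real-number endgames (kept free of the variational context) -/

/-- `1 ≤ (1 − 2ε)·e^{4ε}` for `0 ≤ ε ≤ 1/4` (`e^{4ε} ≥ 1 + 4ε` and `(1 − 2ε)(1 + 4ε) = 1 + 2ε(1 − 4ε) ≥ 1`). [folklore] -/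
theorem one_le_one_sub_two_mul_mul_exp {ε : ℝ} (h0 : 0 ≤ ε) (h4 : ε ≤ 1 / 4) : 1 ≤ (1 - 2 * ε) * Real.exp (4 * ε) := by
  have he : 4 * ε + 1 ≤ Real.exp (4 * ε) := Real.add_one_le_exp _
  have h12 : 0 ≤ 1 - 2 * ε := by linarith
  calc (1 : ℝ) ≤ (1 - 2 * ε) * (4 * ε + 1) := by nlinarith
    _ ≤ (1 - 2 * ε) * Real.exp (4 * ε) := mul_le_mul_of_nonneg_left he h12

/-- ★ **Clause-two numerics.**  `0 ≤ s ≤ λ₁`, `λ₀(1 − 2ε) ≤ t`, `0 ≤ λ₀`, `0 ≤ ε ≤ 1/4`, `4εL ≤ c` ⟹ `s^L·λ₀^L ≤ e^{c}·(λ₁^L·t^L)`. [folklore] -/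
theorem clause_two_numeric {s t lam₀ lam₁ ε c : ℝ} {L : ℕ} (hs0 : 0 ≤ s) (hs : s ≤ lam₁) (hlam₀ : 0 ≤ lam₀)
    (ht : lam₀ * (1 - 2 * ε) ≤ t) (hε0 : 0 ≤ ε) (hε4 : ε ≤ 1 / 4) (hc : 4 * ε * L ≤ c) :
    s ^ L * lam₀ ^ L ≤ Real.exp c * (lam₁ ^ L * t ^ L) := by
  have h1 := one_le_one_sub_two_mul_mul_exp hε0 hε4
  have ht0 : 0 ≤ t := le_trans (mul_nonneg hlam₀ (by linarith)) ht
  have hlt : lam₀ ≤ t * Real.exp (4 * ε) := by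
    calc lam₀ = lam₀ * 1 := (mul_one _).symm
      _ ≤ lam₀ * ((1 - 2 * ε) * Real.exp (4 * ε)) := mul_le_mul_of_nonneg_left h1 hlam₀
      _ = lam₀ * (1 - 2 * ε) * Real.exp (4 * ε) := by ring
      _ ≤ t * Real.exp (4 * ε) := mul_le_mul_of_nonneg_right ht (Real.exp_pos _).le
  have hpowl : lam₀ ^ L ≤ t ^ L * Real.exp c := by
    calc lam₀ ^ L ≤ (t * Real.exp (4 * ε)) ^ L := pow_le_pow_left₀ hlam₀ hlt L
      _ = t ^ L * Real.exp (L * (4 * ε)) := by rw [mul_pow, ← Real.exp_nat_mul]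
      _ ≤ t ^ L * Real.exp c := by
          refine mul_le_mul_of_nonneg_left (Real.exp_le_exp.2 ?_) (pow_nonneg ht0 _)
          linarith
  have hpows : s ^ L ≤ lam₁ ^ L := pow_le_pow_left₀ hs0 hs L
  calc s ^ L * lam₀ ^ L ≤ lam₁ ^ L * (t ^ L * Real.exp c) :=
        mul_le_mul hpows hpowl (pow_nonneg hlam₀ _) (pow_nonneg (hs0.trans hs) _)
    _ = Real.exp c * (lam₁ ^ L * t ^ L) := by ring

/-- ★ **Clause-one numerics.**  `0 ≤ t ≤ λ₀`, `0 ≤ λ₁`, `λ₁ − 4ελ₀ ≤ s`, `0 < L`, `4ελ₀L·e^{c/L} ≤ λ₁c` ⟹ `λ₁^L·t^L ≤ e^{c}·(s^L·λ₀^L)`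
(`e^{c/L} − 1 ≥ c/L`). [folklore] -/
theorem clause_one_numeric {s t lam₀ lam₁ ε c : ℝ} {L : ℕ} (ht0 : 0 ≤ t) (ht : t ≤ lam₀) (hlam₁ : 0 ≤ lam₁)
    (hs : lam₁ - 4 * ε * lam₀ ≤ s) (hL : 0 < L) (hc : 4 * ε * lam₀ * L * Real.exp (c / L) ≤ lam₁ * c) :
    lam₁ ^ L * t ^ L ≤ Real.exp c * (s ^ L * lam₀ ^ L) := by
  have hLr : (0 : ℝ) < L := by exact_mod_cast hL
  have hex : c / L + 1 ≤ Real.exp (c / L) := Real.add_one_le_exp _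
  have h1 : 4 * ε * lam₀ * Real.exp (c / L) ≤ lam₁ * (c / L) := by
    rw [mul_div_assoc', le_div_iff₀ hLr]
    calc 4 * ε * lam₀ * Real.exp (c / L) * L = 4 * ε * lam₀ * L * Real.exp (c / L) := by ring
      _ ≤ lam₁ * c := hc
  have hkey : lam₁ ≤ Real.exp (c / L) * s := by
    have h2 : lam₁ * (c / L + 1) ≤ lam₁ * Real.exp (c / L) := mul_le_mul_of_nonneg_left hex hlam₁
    calc lam₁ = lam₁ * (c / L + 1) - lam₁ * (c / L) := by ring
      _ ≤ lam₁ * Real.exp (c / L) - 4 * ε * lam₀ * Real.exp (c / L) := by linarith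
      _ = Real.exp (c / L) * (lam₁ - 4 * ε * lam₀) := by ring
      _ ≤ Real.exp (c / L) * s := mul_le_mul_of_nonneg_left hs (Real.exp_pos _).le
  have hs0 : 0 ≤ s :=
    le_of_mul_le_mul_left ((mul_zero _).le.trans (hlam₁.trans hkey) : Real.exp (c / L) * 0 ≤ Real.exp (c / L) * s)
      (Real.exp_pos _)
  have hpow1 : lam₁ ^ L ≤ Real.exp c * s ^ L := by
    calc lam₁ ^ L ≤ (Real.exp (c / L) * s) ^ L := pow_le_pow_left₀ hlam₁ hkey L
      _ = Real.exp c * s ^ L := by rw [mul_pow, ← Real.exp_nat_mul, mul_div_cancel₀ c hLr.ne']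
  have hpow2 : t ^ L ≤ lam₀ ^ L := pow_le_pow_left₀ ht0 ht L
  calc lam₁ ^ L * t ^ L ≤ (Real.exp c * s ^ L) * lam₀ ^ L :=
        mul_le_mul hpow1 hpow2 (pow_nonneg ht0 _) (mul_nonneg (Real.exp_pos _).le (pow_nonneg hs0 _))
    _ = Real.exp c * (s ^ L * lam₀ ^ L) := by ring

/-- Level bookkeeping: `0 < lam ≤ 1/(16(C'+1))`, `Λ ≤ 2·lam` ⟹ `4·C'·Λ² ≤ 1` (and `lam ≤ 1`). [folklore] -/
theorem four_mul_sq_le_one {C' lam Λ : ℝ} (hC' : 0 ≤ C') (hlam : 0 < lam) (hle : lam ≤ 1 / (16 * (C' + 1)))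
    (hΛ0 : 0 ≤ Λ) (hΛ : Λ ≤ 2 * lam) : 4 * C' * Λ ^ 2 ≤ 1 := by
  have h16 : 16 * (C' + 1) * lam ≤ 1 := by
    have := (le_div_iff₀ (by positivity : (0 : ℝ) < 16 * (C' + 1))).1 hle
    linarith
  have hlam1 : lam ≤ 1 := by nlinarith
  have hΛ2 : Λ ^ 2 ≤ 4 * lam := by nlinarith
  nlinarith

/-- The mass bound from (R): `λ₀·(X·m) ≤ C·Λ²·λ₁`, `0 < λ₀`, `0 < X` ⟹ `m ≤ CΛ²λ₁/(λ₀X)`. [folklore] -/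
theorem mass_le_eps {lam₀ lam₁ X m C Λ : ℝ} (hlam₀ : 0 < lam₀) (hX : 0 < X) (h : lam₀ * (X * m) ≤ C * Λ ^ 2 * lam₁) :
    m ≤ C * Λ ^ 2 * lam₁ / (lam₀ * X) := by
  rw [le_div_iff₀ (mul_pos hlam₀ hX)]
  calc m * (lam₀ * X) = lam₀ * (X * m) := by ring
    _ ≤ _ := h

/-- `ε = CΛ²λ₁/(λ₀ L^{1+σ}) ≤ 1/4` when `4·(12(C+1))·Λ² ≤ 1`, `λ₁ ≤ λ₀`, `1 ≤ L^{1+σ}`. [folklore] -/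
theorem eps_le_quarter {lam₀ lam₁ X C Λ : ℝ} (hC : 0 ≤ C) (hlam₀ : 0 < lam₀) (hlam₁ : lam₁ ≤ lam₀)
    (hX : 1 ≤ X) (hsmall : 4 * (12 * (C + 1)) * Λ ^ 2 ≤ 1) :
    C * Λ ^ 2 * lam₁ / (lam₀ * X) ≤ 1 / 4 := by
  rw [div_le_iff₀ (mul_pos hlam₀ (by linarith))]
  have h1 : C * Λ ^ 2 * lam₁ ≤ C * Λ ^ 2 * lam₀ := mul_le_mul_of_nonneg_left hlam₁ (by positivity)
  have h2 : C * Λ ^ 2 ≤ 1 / 4 := by nlinarith [sq_nonneg Λ]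
  calc C * Λ ^ 2 * lam₁ ≤ C * Λ ^ 2 * lam₀ := h1
    _ ≤ 1 / 4 * lam₀ := mul_le_mul_of_nonneg_right h2 hlam₀.le
    _ ≤ 1 / 4 * (lam₀ * X) := by nlinarith

/-- Clause-two side condition: `4εL ≤ c` for `ε = CΛ²λ₁/(λ₀·(L·L^σ))`, `c = 12(C+1)Λ²/L^σ`. [folklore] -/
theorem four_eps_L_le {lam₀ lam₁ Lr Ls C Λ : ℝ} (hC : 0 ≤ C) (hlam₀ : 0 < lam₀) (hlam₁0 : 0 ≤ lam₁) (hlam₁ : lam₁ ≤ lam₀)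
    (hLr : 0 < Lr) (hLs : 0 < Ls) :
    4 * (C * Λ ^ 2 * lam₁ / (lam₀ * (Lr * Ls))) * Lr ≤ 12 * (C + 1) * Λ ^ 2 / Ls := by
  rw [show 4 * (C * Λ ^ 2 * lam₁ / (lam₀ * (Lr * Ls))) * Lr = (4 * C * Λ ^ 2 * (lam₁ / lam₀)) / Ls by
    field_simp]
  refine div_le_div_of_nonneg_right ?_ hLs.le
  have hr : lam₁ / lam₀ ≤ 1 := (div_le_one hlam₀).2 hlam₁
  have hr0 : 0 ≤ lam₁ / lam₀ := div_nonneg hlam₁0 hlam₀.le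
  nlinarith [mul_nonneg (mul_nonneg hC (sq_nonneg Λ)) hr0, sq_nonneg Λ]

/-- Clause-one side condition: `4ελ₀L·e^{c/L} ≤ λ₁c` for `ε = CΛ²λ₁/(λ₀·(L·L^σ))`, `c = 12(C+1)Λ²/L^σ`, `c/L ≤ 1` (`e ≤ 3`). [folklore] -/
theorem four_eps_lam_L_exp_le {lam₀ lam₁ Lr Ls C Λ c : ℝ} (hC : 0 ≤ C) (hlam₀ : 0 < lam₀) (hlam₁0 : 0 ≤ lam₁)
    (hLr : 0 < Lr) (hLs : 0 < Ls) (hc : c = 12 * (C + 1) * Λ ^ 2 / Ls) (hcL : c / Lr ≤ 1) :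
    4 * (C * Λ ^ 2 * lam₁ / (lam₀ * (Lr * Ls))) * lam₀ * Lr * Real.exp (c / Lr) ≤ lam₁ * c := by
  have he : Real.exp (c / Lr) ≤ 3 := (Real.exp_le_exp.2 hcL).trans (by simpa using Real.exp_one_lt_three.le)
  have hA : 4 * (C * Λ ^ 2 * lam₁ / (lam₀ * (Lr * Ls))) * lam₀ * Lr = 4 * C * Λ ^ 2 * lam₁ / Ls := by
    field_simp
  rw [hA]
  have h0 : 0 ≤ 4 * C * Λ ^ 2 * lam₁ / Ls := by positivity
  calc 4 * C * Λ ^ 2 * lam₁ / Ls * Real.exp (c / Lr) ≤ 4 * C * Λ ^ 2 * lam₁ / Ls * 3 :=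
        mul_le_mul_of_nonneg_left he h0
    _ = (12 * C * Λ ^ 2 / Ls) * lam₁ := by ring
    _ ≤ (12 * (C + 1) * Λ ^ 2 / Ls) * lam₁ := by
        refine mul_le_mul_of_nonneg_right (div_le_div_of_nonneg_right ?_ hLs.le) hlam₁0
        nlinarith [sq_nonneg Λ]
    _ = lam₁ * c := by rw [hc]; ring

/-- `c/L ≤ 1` for `c = 12(C+1)Λ²/L^σ` when `4·12(C+1)·Λ² ≤ 1`, `1 ≤ L`, `1 ≤ L^σ`. [folklore] -/
theorem c_div_L_le_one {C Λ Lr Ls : ℝ} (hLr : 1 ≤ Lr) (hLs : 1 ≤ Ls) (hsmall : 4 * (12 * (C + 1)) * Λ ^ 2 ≤ 1) :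
    12 * (C + 1) * Λ ^ 2 / Ls / Lr ≤ 1 := by
  rw [div_div, div_le_one (by nlinarith)]
  nlinarith [sq_nonneg Λ]

/-! ## §3 The top pair of exact eigenfunctions; the generic reduction -/

/-- On the femto side (`β > 0`) there is an `l2`-orthonormal pair of physical exact eigenfunctions `K_βΩ₀ = λ₀Ω₀`, `K_βΩ₁ = λ₁Ω₁`
(`λ₀ = topValue`, `λ₁ = secondValue`). [cite: ReedSimonIV1978, Thm. XIII.1] -/
theorem exists_top_pair {β : ℝ} (hβ : 0 < β) :
    ∃ Ω₀ Ω₁ : GaugeConfig 3 L SU2 → ℝ, IsPhys Ω₀ ∧ IsPhys Ω₁ ∧ l2 Ω₀ Ω₀ = 1 ∧ l2 Ω₁ Ω₁ = 1 ∧ l2 Ω₀ Ω₁ = 0 ∧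
      transferApply β Ω₀ = topValue su2Rep L β • Ω₀ ∧ transferApply β Ω₁ = secondValue su2Rep L β • Ω₁ := by
  obtain ⟨φ, hφ, hon, heig⟩ := exists_isPhys_eigenfamily_of_pos (L := L) hβ 1
  refine ⟨φ 0, φ 1, hφ 0, hφ 1, by simpa using hon 0 0, by simpa using hon 1 1, by simpa using hon 0 1, ?_, ?_⟩
  · have h := heig 0
    rwa [show ((0 : Fin 2) : ℕ) = 0 from rfl, levelValue_zero] at h
  · have h := heig 1
    rwa [show ((1 : Fin 2) : ℕ) = 1 from rfl, levelValue_one] at h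

/-- ★★★ **Generic reduction: compressed comparison ⟸ eigen large-field rarity.**  `B L β` is any family of «bad» events whose good/bad
cut-offs of physical test functions stay physical.  If (R) every normalised physical exact eigenfunction for `λ₀` or `λ₁` has bad mass
`m` with `λ₀ · (L^{1+σ} · m) ≤ C · Λ² · λ₁` on the window lattices, then with `C' = 12(C+1)`: `0 < t`, `λ₁^L t^L ≤ e^{C'Λ²/L^σ} s^L λ₀^L` and
`s^L λ₀^L ≤ e^{C'Λ²/L^σ} λ₁^L t^L` for the `B`-compressed values `t = sSup rayleighSet(P)`, `s = sInf_φ sSup rayleighSet(P ∧ ⊥φ)`,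
`P ψ ≡ ∀ U, B U → ψ U = 0`. [cite: ReedSimonIV1978, Thm. XIII.1] -/
theorem compressedComparison_of_eigenRarity (B : ∀ L : ℕ, ℝ → GaugeConfig 3 L SU2 → Prop)
    (hB : ∀ (L : ℕ) [NeZero L] (β : ℝ) (f : GaugeConfig 3 L SU2 → ℝ), IsPhys f →
      IsPhys ({U | ¬ B L β U}.indicator f) ∧ IsPhys ({U | ¬ B L β U}ᶜ.indicator f))
    {σ : ℝ} (hσ : 0 < σ) {C lam0 : ℝ} {L0 : ℕ} (hC : 0 ≤ C)
    (hR : ∀ lam : ℝ, 0 < lam → lam ≤ lam0 → ∀ (L : ℕ) [NeZero L], L0 ≤ L → ∀ β : ℝ, InFemtoWindow lam β L →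
        ∀ Ω : GaugeConfig 3 L SU2 → ℝ, IsPhys Ω → l2 Ω Ω = 1 →
          (transferApply β Ω = topValue su2Rep L β • Ω ∨ transferApply β Ω = secondValue su2Rep L β • Ω) →
          topValue su2Rep L β * ((L : ℝ) ^ (1 + σ) * l2 ({U | B L β U}.indicator Ω) ({U | B L β U}.indicator Ω))
            ≤ C * luscherLambda β L ^ 2 * secondValue su2Rep L β) :
    ∀ lam : ℝ, 0 < lam → lam ≤ min lam0 (1 / (16 * (12 * (C + 1) + 1))) → ∀ (L : ℕ) [NeZero L], L0 ≤ L → ∀ β : ℝ,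
      InFemtoWindow lam β L →
        0 < sSup (rayleighSet su2Rep L β fun ψ => ∀ U, B L β U → ψ U = 0) ∧
        secondValue su2Rep L β ^ L * sSup (rayleighSet su2Rep L β fun ψ => ∀ U, B L β U → ψ U = 0) ^ L ≤
          Real.exp (12 * (C + 1) * luscherLambda β L ^ 2 / (L : ℝ) ^ σ) *
            (sInf {x : ℝ | ∃ φ : GaugeConfig 3 L SU2 → ℝ, IsPhys φ ∧
              x = sSup (rayleighSet su2Rep L β fun ψ => (∀ U, B L β U → ψ U = 0) ∧ l2 ψ φ = 0)} ^ L * topValue su2Rep L β ^ L) ∧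
        sInf {x : ℝ | ∃ φ : GaugeConfig 3 L SU2 → ℝ, IsPhys φ ∧
            x = sSup (rayleighSet su2Rep L β fun ψ => (∀ U, B L β U → ψ U = 0) ∧ l2 ψ φ = 0)} ^ L * topValue su2Rep L β ^ L ≤
          Real.exp (12 * (C + 1) * luscherLambda β L ^ 2 / (L : ℝ) ^ σ) *
            (secondValue su2Rep L β ^ L * sSup (rayleighSet su2Rep L β fun ψ => ∀ U, B L β U → ψ U = 0) ^ L) := by
  intro lam hlam hle L _ hL0 β hW
  have hle0 : lam ≤ lam0 := hle.trans (min_le_left _ _)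
  have hle1 : lam ≤ 1 / (16 * (12 * (C + 1) + 1)) := hle.trans (min_le_right _ _)
  set T : Set (GaugeConfig 3 L SU2) := {U | ¬ B L β U} with hTdef
  have hTc : Tᶜ = {U | B L β U} := compl_setOf_not _
  set P : (GaugeConfig 3 L SU2 → ℝ) → Prop := fun ψ => ∀ U, B L β U → ψ U = 0 with hPdef
  set lam₀ := topValue su2Rep L β with hlam₀def
  set lam₁ := secondValue su2Rep L β with hlam₁def
  set Λ := luscherLambda β L with hΛdef
  -- signs
  have hβ : 0 < β := zero_lt_one.trans_le hW.1
  have hlam₀pos : 0 < lam₀ := topValue_su2Rep_pos L β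
  have hlam₁pos : 0 < lam₁ := secondValue_su2Rep_pos hβ
  have hlam₁le : lam₁ ≤ lam₀ := by
    rw [hlam₁def, hlam₀def, ← levelValue_one]; exact levelValue_su2Rep_le_topValue L β 1
  have hLpos : 0 < L := Nat.pos_of_ne_zero (NeZero.ne L)
  have hLr : (0 : ℝ) < L := by exact_mod_cast hLpos
  have hL1 : (1 : ℝ) ≤ L := by exact_mod_cast hLpos
  have hLs : 0 < (L : ℝ) ^ σ := Real.rpow_pos_of_pos hLr _
  have hLs1 : 1 ≤ (L : ℝ) ^ σ := Real.one_le_rpow hL1 hσ.le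
  have hsplit : (L : ℝ) ^ (1 + σ) = (L : ℝ) * (L : ℝ) ^ σ := by rw [Real.rpow_add hLr, Real.rpow_one]
  have hX : 0 < (L : ℝ) * (L : ℝ) ^ σ := mul_pos hLr hLs
  have hX1 : 1 ≤ (L : ℝ) * (L : ℝ) ^ σ := by nlinarith
  obtain ⟨hΛlo, hΛhi⟩ := luscherLambda_mem_of_window hW
  have hΛ0 : 0 ≤ Λ := (hlam.trans_le hΛlo).le
  have hsmall : 4 * (12 * (C + 1)) * Λ ^ 2 ≤ 1 := four_mul_sq_le_one (by positivity) hlam hle1 hΛ0 hΛhi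
  -- cut-offs
  have hT : ∀ {f : GaugeConfig 3 L SU2 → ℝ}, IsPhys f → IsPhys (T.indicator f) ∧ IsPhys (Tᶜ.indicator f) :=
    fun hf => hB L β _ hf
  have hPT : ∀ f : GaugeConfig 3 L SU2 → ℝ, P (T.indicator f) := fun f => indicator_good_vanishes (B L β) f
  -- eigenpair and masses
  obtain ⟨Ω₀, Ω₁, hΩ₀, hΩ₁, hn₀, hn₁, horth, heig₀, heig₁⟩ := exists_top_pair (L := L) hβ
  set ε : ℝ := C * Λ ^ 2 * lam₁ / (lam₀ * ((L : ℝ) * (L : ℝ) ^ σ)) with hεdef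
  have hε0 : 0 ≤ ε := by rw [hεdef]; positivity
  have hmass : ∀ {Ω : GaugeConfig 3 L SU2 → ℝ}, IsPhys Ω → l2 Ω Ω = 1 →
      (transferApply β Ω = lam₀ • Ω ∨ transferApply β Ω = lam₁ • Ω) → l2 (Tᶜ.indicator Ω) (Tᶜ.indicator Ω) ≤ ε := by
    intro Ω hΩ hn heig
    have h := hR lam hlam hle0 L hL0 β hW Ω hΩ hn heig
    rw [← hTc, hsplit] at h
    exact mass_le_eps hlam₀pos hX h
  have hm₀ := hmass hΩ₀ hn₀ (Or.inl heig₀)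
  have hm₁ := hmass hΩ₁ hn₁ (Or.inr heig₁)
  have hε4 : ε ≤ 1 / 4 := eps_le_quarter hC hlam₀pos hlam₁le hX1 hsmall
  have hεhalf : ε < 1 / 2 := by linarith
  -- the exponent
  set c : ℝ := 12 * (C + 1) * Λ ^ 2 / (L : ℝ) ^ σ with hcdef
  have hcL : c / L ≤ 1 := c_div_L_le_one hL1 hLs1 hsmall
  -- the four variational bounds
  have ht_le := sSup_rayleighSet_le_topValue hβ.le P
  have ht0 := sSup_rayleighSet_nonneg hβ.le P
  have hs_le := compressedSecond_le_secondValue hβ.le P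
  have hs0 := compressedSecond_nonneg hβ.le P
  have ht_ge : lam₀ * (1 - 2 * ε) ≤ sSup (rayleighSet su2Rep L β P) :=
    le_sSup_rayleighSet_of_eigen_cut hβ.le hlam₀pos.le hεhalf hΩ₀ (hT hΩ₀).1 (hT hΩ₀).2 (hPT Ω₀)
      (by rw [hn₀]; exact one_pos) heig₀ (by rw [hn₀, mul_one]; exact hm₀)
  have hs_ge := le_compressedSecond_of_eigen_pair_cut hβ.le hT hPT hlam₁pos.le hlam₁le hεhalf hΩ₀ hΩ₁ hn₀ hn₁ horth
      heig₀ heig₁ hm₀ hm₁ (P := P)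
  refine ⟨lt_of_lt_of_le (mul_pos hlam₀pos (by linarith)) ht_ge, ?_, ?_⟩
  · exact clause_one_numeric ht0 ht_le hlam₁pos.le hs_ge hLpos
      (four_eps_lam_L_exp_le hC hlam₀pos hlam₁pos.le hLr hLs hcdef hcL)
  · exact clause_two_numeric hs0 hs_le hlam₀pos.le ht_ge hε0 hε4
      (four_eps_L_le hC hlam₀pos hlam₁pos.le hlam₁le hLr hLs)

/-! ## §4 The crux text behind the rarity hypothesis -/

/-- ★★★ **`LargeFieldInsensitivity` (text of the route decl, rev 12, verbatim) from eigen large-field rarity for the SF_κ plaquette event.**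
Hypothesis (R): for every `κ ∈ (0,1)`, `σ > 0` there are `C ≥ 0`, `lam0 > 0`, `L0` such that on every window lattice `(L ≥ L0, β)` at level
`lam ≤ lam0`, every physical `Ω` with `‖Ω‖² = 1` which is an exact eigenfunction for `λ₀` or for `λ₁` satisfies
`λ₀ · (L^{1+σ} · ‖1_{∃ p, β^{κ−1} < 2 − Re tr U_p} Ω‖²) ≤ C · Λ² · λ₁`. [cite: ReedSimonIV1978, Thm. XIII.1] -/
theorem largeFieldInsensitivity_text_of_eigenRarity
    (hR : ∀ κ σ : ℝ, 0 < κ → κ < 1 → 0 < σ → ∃ (C lam0 : ℝ) (L0 : ℕ), 0 ≤ C ∧ 0 < lam0 ∧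
      ∀ lam : ℝ, 0 < lam → lam ≤ lam0 → ∀ (L : ℕ) [NeZero L], L0 ≤ L → ∀ β : ℝ, InFemtoWindow lam β L →
        ∀ Ω : GaugeConfig 3 L SU2 → ℝ, IsPhys Ω → l2 Ω Ω = 1 →
          (transferApply β Ω = topValue su2Rep L β • Ω ∨ transferApply β Ω = secondValue su2Rep L β • Ω) →
          topValue su2Rep L β * ((L : ℝ) ^ (1 + σ) *
            l2 ({U : GaugeConfig 3 L SU2 | ∃ p : Plaquette 3 L,
                  β ^ (κ - 1) < 2 - (su2Rep (plaquetteHolonomy U p.1 p.2.1.1 p.2.1.2)).trace.re}.indicator Ω)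
               ({U : GaugeConfig 3 L SU2 | ∃ p : Plaquette 3 L,
                  β ^ (κ - 1) < 2 - (su2Rep (plaquetteHolonomy U p.1 p.2.1.1 p.2.1.2)).trace.re}.indicator Ω))
            ≤ C * luscherLambda β L ^ 2 * secondValue su2Rep L β) :
    ∀ κ σ : ℝ, 0 < κ → κ < 1 → 0 < σ → ∃ (C lam0 : ℝ) (L0 : ℕ), 0 ≤ C ∧ 0 < lam0 ∧ ∀ lam : ℝ, 0 < lam → lam ≤ lam0 →
      ∀ (L : ℕ) [NeZero L], L0 ≤ L → ∀ β : ℝ, InFemtoWindow lam β L →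
        let P : (Literature.MathematicalPhysics.QuantumFieldTheory.GaugeConfig 3 L SU2 → ℝ) → Prop := fun ψ => ∀ U,
          (∃ p : Literature.MathematicalPhysics.QuantumFieldTheory.Plaquette 3 L,
            β ^ (κ - 1) < 2 - (su2Rep (Literature.MathematicalPhysics.QuantumFieldTheory.plaquetteHolonomy U p.1 p.2.1.1 p.2.1.2)).trace.re) →
          ψ U = 0;
        0 < sSup (rayleighSet su2Rep L β P) ∧
        secondValue su2Rep L β ^ L * sSup (rayleighSet su2Rep L β P) ^ L ≤
          Real.exp (C * luscherLambda β L ^ 2 / (L : ℝ) ^ σ) *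
            (sInf {x : ℝ | ∃ φ : Literature.MathematicalPhysics.QuantumFieldTheory.GaugeConfig 3 L SU2 → ℝ, IsPhys φ ∧
              x = sSup (rayleighSet su2Rep L β fun ψ => P ψ ∧ l2 ψ φ = 0)} ^ L * topValue su2Rep L β ^ L) ∧
        sInf {x : ℝ | ∃ φ : Literature.MathematicalPhysics.QuantumFieldTheory.GaugeConfig 3 L SU2 → ℝ, IsPhys φ ∧
            x = sSup (rayleighSet su2Rep L β fun ψ => P ψ ∧ l2 ψ φ = 0)} ^ L * topValue su2Rep L β ^ L ≤
          Real.exp (C * luscherLambda β L ^ 2 / (L : ℝ) ^ σ) * (secondValue su2Rep L β ^ L * sSup (rayleighSet su2Rep L β P) ^ L) := by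
  intro κ σ hκ0 hκ1 hσ
  obtain ⟨C, lam0, L0, hC, hlam0, hR⟩ := hR κ σ hκ0 hκ1 hσ
  refine ⟨12 * (C + 1), min lam0 (1 / (16 * (12 * (C + 1) + 1))), L0, by positivity, lt_min hlam0 (by positivity), ?_⟩
  intro lam hlam hle L _ hL0 β hW
  exact compressedComparison_of_eigenRarity
    (fun L β U => ∃ p : Plaquette 3 L, β ^ (κ - 1) < 2 - (su2Rep (plaquetteHolonomy U p.1 p.2.1.1 p.2.1.2)).trace.re)
    (fun L _ β f hf => sf_cutoffs_isPhys (β ^ (κ - 1)) hf) hσ hC hR lam hlam hle L hL0 β hW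

/-! ## §5 CAVEAT on the hypothesis (R) (appended by the same seat after the refuter's and the FCL lead's readings of 25696, 2026-08-28)

The «D-0014 READING» in the header calls the rate of (R) mild.  IT IS NOT.  Along the femto window at FIXED level the bare coupling grows only
logarithmically, `β = 2Λ⁻³ + 4b₀ log L + O(log β)` (tree `luscherLambda`; kernel bound `WindowCoupling.beta_le_of_window`; not the «β ~ L³/Λ³»
of the item's docstring), so the single-plaquette tail `≈ e^{−cβ^κ}` is `L`-independent against `3L³` plaquettes and the GLOBAL small-field
event becomes ATYPICAL under the vacuum as `L → ∞` (refuter memo LFI-25696-suspect-false.md, Table B; lead verdict MISSTATED-25696.md).  Hence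
(R) is expected to FAIL along every tower, and §4 is to be read as a precise record that the ABSOLUTE-RARITY mechanism (cut eigenfunctions)
cannot reach 25696 — nor its repair with slack `e^{CΛ²/L^σ + A/β²}` — in the `L → ∞` regime: there `t_κ ≪ λ₀`, and only a RATIO mechanism
(uniform killing of the ground-state chain on the typical bad event ≈ a tiny local `β`-shift) can compare `s_κ/t_κ` with `λ₁/λ₀`.  What
survives: `0 ≤ t ≤ λ₀`, `0 ≤ s ≤ λ₁` (companion §1), the generic §3 for events that ARE rare (fixed-`L` action tubes of `FlatTubeReduction`), and
`0 < t_κ` unconditionally (`smallFieldTop_pos`, FCL lead, `…LargeFieldInsensitivityTopPos.lean`). -/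

end SFCompression

end Summit.QuantumFields.YangMills.Theorems.FemtoTransferGap

end
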